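import Summits.ResolutionOfSingularities.ResolutionOfSingularities.Theorems.EquisingularLiftEquisingularLiftNatLiftableNoseClass2Defs
import Summits.ResolutionOfSingularities.ResolutionOfSingularities.Theorems.EquisingularLiftEquisingularLiftNatRatLiftRegular
import Summits.ResolutionOfSingularities.ResolutionOfSingularities.Theorems.EquisingularLiftEquisingularLiftNatRatLiftMonomialCurves
import HarnessLib

/-!
# [OURS · L1 W4.5(b) · EL♮(3)] The level-2 liftable nose class LIFTS, and the successor rung «LIFTABLE NOSE CLASS (+ rational curves), THEN POINTS»

Cell `res-hironaka`, rung L, slot W4.5(b); crux **EL♮(3)** (stmt-ResolutionOfSingularities-20148) / EL♮ (stmt-20038); successor of the v6‴ rung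
`stub_elnat_liftableNoseThenPoints` (CLOSED p531946), re-cut of the residue `stub_elnat_three_nonisolated_nonliftclass` (skeleton v12 / child v10).
OURS; NOT a statement of any manuscript; AI-written, weaker than expert review. No definition, no `sorry`, standard axioms.
`--supports stmt-ResolutionOfSingularities-20148`.

* `lift_of_isLiftableNoseClass₂` — every member of `IsLiftableNoseClass₂` (…NatLiftableNoseClass2Defs) is an `IsLiftableCentre`: `base` ↦
  `lift_of_isLiftableNoseClass` (p531946); `rat` ↦ res-type-032's `RatLift.isLiftableCentre_of_forms` (p535680 = T-RATLIFT-ALG ∘ res-type-051's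
  `SatLift.liftableCentre_of_saturatedLift` p530902) with `hZreg := RatReg.isRegular_subscheme_vanishingIdeal_of_clause'` (T-RATREG p534148);
  `union` ↦ `liftableCentre_union` (p531946).
* `stub_elnat_liftableNoseClassTwoThenPoints` — the successor rung text (= L/res-L1-w45b-lead-2/TARGET-LIFTCLASS.sig.txt with `IsLiftableNoseClass₂` for
  `IsLiftableNoseClass`), closed by `elnat_noseThenPoints_of_liftableCentre` (p525611) ∘ `lift_of_isLiftableNoseClass₂`. (The successor lead registers
  the text of its choice; if it is this one, the registered stub is closed by this declaration.)
-/

set_option linter.dupNamespace false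

noncomputable section

open CategoryTheory AlgebraicGeometry TopologicalSpace MvPolynomial

namespace Summit.ResolutionOfSingularities.ResolutionOfSingularities.Cruxes.EquisingularLiftNat.Sections

/-- **The level-2 class lifts**: `base` ↦ `lift_of_isLiftableNoseClass` (p531946), `rat` ↦ res-type-032's `RatLift.isLiftableCentre_of_forms` with
`hZreg := RatReg.isRegular_subscheme_vanishingIdeal_of_clause'` (T-RATREG, p534148), `union` ↦ `liftableCentre_union` (p531946).
[cite: Hartshorne1977, III Prop. 9.7 and Thm. 10.2] -/
theorem lift_of_isLiftableNoseClass₂ (k : Type) [Field k] [IsAlgClosed k] (n : ℕ)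
    {Z : Set (Literature.AlgebraicGeometry.Motives.projectiveSpace n k).left} (h : IsLiftableNoseClass₂ k n Z) (hZ : IsClosed Z) :
    IsLiftableCentre k n Z hZ := by
  haveI : PerfectField k := IsAlgClosed.perfectField k
  induction h with
  | base Z h => exact lift_of_isLiftableNoseClass k n h hZ
  | rat r e m₀ f h =>
    obtain ⟨hf, he, hcl⟩ := h
    exact RatLift.isLiftableCentre_of_forms k n f he hf hcl _ hZ rfl
      (RatReg.isRegular_subscheme_vanishingIdeal_of_clause' f he hf hcl _ hZ rfl)
  | union Z₁ Z₂ h₁ h₂ hdisj ih₁ ih₂ =>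
    exact liftableCentre_union k n h₁.isClosed h₂.isClosed (ih₁ h₁.isClosed) (ih₂ h₂.isClosed) hdisj

set_option linter.overlappingInstances false in
/-- **DRAFT successor rung «LIFTABLE NOSE CLASS (level 2: + rational curves), THEN POINTS»** = TARGET-LIFTCLASS.sig.txt with `IsLiftableNoseClass₂`
for `IsLiftableNoseClass` (the successor lead registers the text; this decl shows it closes by `elnat_noseThenPoints_of_liftableCentre` ∘
`lift_of_isLiftableNoseClass₂`). OURS; not a statement of any manuscript. [cite: Hartshorne1977, III Prop. 9.7; StacksProject, Tag 01V8] -/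
theorem stub_elnat_liftableNoseClassTwoThenPoints (p : ℕ) : p.Prime → ∀ (k : Type) [Field k] [CharP k p] [IsAlgClosed k] (n : ℕ) (H : AlgebraicGeometry.Scheme.{0}) (ι : H ⟶ (Literature.AlgebraicGeometry.Motives.projectiveSpace n k).left), AlgebraicGeometry.IsClosedImmersion ι → AlgebraicGeometry.IsIntegral H → (∀ y : (Literature.AlgebraicGeometry.Motives.projectiveSpace n k).left, ∃ U : (Literature.AlgebraicGeometry.Motives.projectiveSpace n k).left.affineOpens, y ∈ (U : (Literature.AlgebraicGeometry.Motives.projectiveSpace n k).left.Opens) ∧ (ι.ker.ideal U).IsPrincipal) → (∃ (Z : Set (Literature.AlgebraicGeometry.Motives.projectiveSpace n k).left) (hZ : IsClosed Z), IsLiftableNoseClass₂ k n Z ∧ Z ⊆ Set.range ι ∧ ¬ (Set.range ι ⊆ Z) ∧ (∃ (F₂ : AlgebraicGeometry.Scheme.{0}) (υ : F₂ ⟶ (Literature.AlgebraicGeometry.Motives.projectiveSpace n k).left), Literature.AlgebraicGeometry.Resolution.IsBlowup υ (AlgebraicGeometry.Scheme.IdealSheafData.vanishingIdeal (⟨Z,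 hZ⟩ : TopologicalSpace.Closeds (Literature.AlgebraicGeometry.Motives.projectiveSpace n k).left)) ∧ ∃ (F' : AlgebraicGeometry.Scheme.{0}) (ρ' : F' ⟶ F₂) (T' : Set F'), (∀ Q : (∀ F₁ : AlgebraicGeometry.Scheme.{0}, (F₁ ⟶ F₂) → Set F₁ → Prop), Q F₂ (CategoryTheory.CategoryStruct.id F₂) (closure (υ ⁻¹' (Set.range ι \ Z))) → (∀ (F₁ F₃ : AlgebraicGeometry.Scheme.{0}) (ρ : F₁ ⟶ F₂) (T₁ : Set F₁) (x : ↥((AlgebraicGeometry.Scheme.IdealSheafData.vanishingIdeal (⟨closure T₁, isClosed_closure⟩ : TopologicalSpace.Closeds F₁))).subscheme) (υ₁ : F₃ ⟶ F₁) (hx : IsClosed ({(((AlgebraicGeometry.Scheme.IdealSheafData.vanishingIdeal (⟨closure T₁, isClosed_closure⟩ : TopologicalSpace.Closeds F₁))).subschemeι x : F₁)} : Set F₁)), Q F₁ ρ T₁ → ¬ IsRegularLocalRing (((AlgebraicGeometry.Scheme.IdealSheafData.vanishingIdeal (⟨closure T₁, isClosed_closure⟩ : TopologicalSpace.Closeds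 F₁))).subscheme.presheaf.stalk x) → Literature.AlgebraicGeometry.Resolution.IsBlowup υ₁ (AlgebraicGeometry.Scheme.IdealSheafData.vanishingIdeal (⟨{(((AlgebraicGeometry.Scheme.IdealSheafData.vanishingIdeal (⟨closure T₁, isClosed_closure⟩ : TopologicalSpace.Closeds F₁))).subschemeι x : F₁)}, hx⟩ : TopologicalSpace.Closeds F₁)) → Q F₃ (CategoryTheory.CategoryStruct.comp υ₁ ρ) (closure (υ₁ ⁻¹' (T₁ \ {(((AlgebraicGeometry.Scheme.IdealSheafData.vanishingIdeal (⟨closure T₁, isClosed_closure⟩ : TopologicalSpace.Closeds F₁))).subschemeι x : F₁)})))) → Q F' ρ' T') ∧ Literature.AlgebraicGeometry.Resolution.Scheme.IsRegular (AlgebraicGeometry.Scheme.IdealSheafData.vanishingIdeal (⟨closure T', isClosed_closure⟩ : TopologicalSpace.Closeds F')).subscheme)) → ∃ (O : Type) (_ : CommRing O) (_ : IsDomain O) (_ : IsDiscreteValuationRing O) (_ : CharZero O) (π : O →+* k), Function.Surjective π ∧ (letI := MvPolynomial.gradedAlgebra (σ := Fin (n + 1)) (R := O); letI := MvPolynomial.gradedAlgebra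 (σ := Fin (n + 1)) (R := k); ∀ (φ : MvPolynomial.homogeneousSubmodule (Fin (n + 1)) O →+*ᵍ MvPolynomial.homogeneousSubmodule (Fin (n + 1)) k) (hφ' : HomogeneousIdeal.irrelevant (MvPolynomial.homogeneousSubmodule (Fin (n + 1)) k) ≤ (HomogeneousIdeal.irrelevant (MvPolynomial.homogeneousSubmodule (Fin (n + 1)) O)).map φ), (∀ s, φ s = MvPolynomial.map π s) → ∀ Y : Set (AlgebraicGeometry.Proj (MvPolynomial.homogeneousSubmodule (Fin (n + 1)) O)), Y = Set.range (CategoryTheory.CategoryStruct.comp ι (AlgebraicGeometry.Proj.map φ hφ') : H ⟶ (AlgebraicGeometry.Proj (MvPolynomial.homogeneousSubmodule (Fin (n + 1)) O))) → ∃ (P' : AlgebraicGeometry.Scheme.{0}) (σ : P' ⟶ (AlgebraicGeometry.Proj (MvPolynomial.homogeneousSubmodule (Fin (n + 1)) O))) (S' : Set P'), (∀ Q : (∀ X' : AlgebraicGeometry.Scheme.{0}, (X' ⟶ (AlgebraicGeometry.Proj (MvPolynomial.homogeneousSubmodule (Fin (n + 1)) O))) → Set X' → Prop), Q (AlgebraicGeometry.Proj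 (MvPolynomial.homogeneousSubmodule (Fin (n + 1)) O)) (CategoryTheory.CategoryStruct.id (AlgebraicGeometry.Proj (MvPolynomial.homogeneousSubmodule (Fin (n + 1)) O))) Y → (∀ (X' X'' : AlgebraicGeometry.Scheme.{0}) (σ' : X' ⟶ (AlgebraicGeometry.Proj (MvPolynomial.homogeneousSubmodule (Fin (n + 1)) O))) (Y' : Set X') (C : X'.IdealSheafData) (τ : X'' ⟶ X'), Q X' σ' Y' → Literature.AlgebraicGeometry.Resolution.IsBlowup τ C → Literature.AlgebraicGeometry.Resolution.Scheme.IsRegular C.subscheme → AlgebraicGeometry.Flat (CategoryTheory.CategoryStruct.comp C.subschemeι (CategoryTheory.CategoryStruct.comp σ' (CategoryTheory.CategoryStruct.comp (AlgebraicGeometry.Proj.toSpecZero (MvPolynomial.homogeneousSubmodule (Fin (n + 1)) O)) (AlgebraicGeometry.Spec.map (CommRingCat.ofHom (algebraMap O (MvPolynomial.homogeneousSubmodule (Fin (n + 1)) O 0))))))) → σ' '' (C.support : Set X') ⊆ {x | ¬ IsGenericPoint x Y} → (C.support : Set X') ∩ (CategoryTheory.CategoryStruct.comp σ' (CategoryTheory.CategoryStruct.comp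 (AlgebraicGeometry.Proj.toSpecZero (MvPolynomial.homogeneousSubmodule (Fin (n + 1)) O)) (AlgebraicGeometry.Spec.map (CommRingCat.ofHom (algebraMap O (MvPolynomial.homogeneousSubmodule (Fin (n + 1)) O 0)))))) ⁻¹' {IsLocalRing.closedPoint O} ⊆ Y' → Q X'' (CategoryTheory.CategoryStruct.comp τ σ') (closure (τ ⁻¹' (Y' \ (C.support : Set X'))))) → Q P' σ S') ∧ Literature.AlgebraicGeometry.Resolution.Scheme.IsRegular (AlgebraicGeometry.Scheme.IdealSheafData.vanishingIdeal (⟨closure S', isClosed_closure⟩ : TopologicalSpace.Closeds P')).subscheme) := by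
  intro hp k _ _ _ n H ι hι hH hloc h
  obtain ⟨Z, hZ, hcls, hsub, hnsub, hdown⟩ := h
  exact elnat_noseThenPoints_of_liftableCentre p hp k n H ι hι hH hloc Z hZ hsub hnsub (lift_of_isLiftableNoseClass₂ k n hcls hZ) hdown

/-! ## Specimens: the `rat` constructor is inhabited outside ci/det (res-type-032's clauses, p535681) -/

/-- **The smooth rational QUARTIC `(s⁴ : s³t : st³ : t⁴) ⊂ ℙ³_k` is in the level-2 class** via `rat` (r = 1, e = 4, m₀ = 2; cofinite clause =
res-type-032's `RatLift.quartic_clause`) — non-ACM, hence outside the `ci`/`det` constructors. [OURS · specimen] [cite: Hartshorne1977, I Ex. 3.18] -/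
theorem quartic_isLiftableNoseClass₂ (k : Type) [Field k] :
    IsLiftableNoseClass₂ k 3 (letI := MvPolynomial.gradedAlgebra (σ := Fin (3 + 1)) (R := k);
      {y : (Literature.AlgebraicGeometry.Motives.projectiveSpace 3 k).left |
        RingHom.ker (MvPolynomial.aeval (R := k)
          (![X 0 ^ 4, X 0 ^ 3 * X 1, X 0 * X 1 ^ 3, X 1 ^ 4] : Fin 4 → MvPolynomial (Fin 2) k)) ≤
          (y : ProjectiveSpectrum (MvPolynomial.homogeneousSubmodule (Fin (3 + 1)) k)).asHomogeneousIdeal.toIdeal}) :=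
  IsLiftableNoseClass₂.rat 1 4 2 (![X 0 ^ 4, X 0 ^ 3 * X 1, X 0 * X 1 ^ 3, X 1 ^ 4] : Fin 4 → MvPolynomial (Fin 2) k)
    ⟨RatLift.quartic_isHomogeneous k, by norm_num, RatLift.quartic_clause k⟩

/-- **Every monomial curve `C_e = (s^e : s^{e-1}t : st^{e-1} : t^e) ⊂ ℙ³_k`, `e ≥ 3`, is in the level-2 class** via `rat` (m₀ = e − 2; res-type-032's
`RatLift.monomialCurve_clause`) — an infinite family, non-ACM for `e ≥ 4`. [OURS · specimen] [cite: Hartshorne1977, I Ex. 3.18] -/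
theorem monomialCurve_isLiftableNoseClass₂ (k : Type) [Field k] {e : ℕ} (he : 3 ≤ e) :
    IsLiftableNoseClass₂ k 3 (letI := MvPolynomial.gradedAlgebra (σ := Fin (3 + 1)) (R := k);
      {y : (Literature.AlgebraicGeometry.Motives.projectiveSpace 3 k).left |
        RingHom.ker (MvPolynomial.aeval (R := k)
          (![X 0 ^ e, X 0 ^ (e - 1) * X 1, X 0 * X 1 ^ (e - 1), X 1 ^ e] : Fin 4 → MvPolynomial (Fin 2) k)) ≤
          (y : ProjectiveSpectrum (MvPolynomial.homogeneousSubmodule (Fin (3 + 1)) k)).asHomogeneousIdeal.toIdeal}) :=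
  IsLiftableNoseClass₂.rat 1 e (e - 2) (![X 0 ^ e, X 0 ^ (e - 1) * X 1, X 0 * X 1 ^ (e - 1), X 1 ^ e] : Fin 4 → MvPolynomial (Fin 2) k)
    ⟨RatLift.monomialCurve_isHomogeneous k (by omega), by omega, RatLift.monomialCurve_clause k he⟩

end Summit.ResolutionOfSingularities.ResolutionOfSingularities.Cruxes.EquisingularLiftNat.Sections

end
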